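import Literature.Barriers.CriticalPhenomena.PlaquetteWalkHoleRootThinSide
import HarnessLib

/-!
# Barrier catalogue (SAWScalingLimit): THE WALL POCKET — the western pocket on the wall EMPTIES the under route;
LAW L's residual west cells for all boxes

Leaf of `PlaquetteWalkHoleRootThinSide` (over/under witnesses on their own blocks, route positivity). The root plaquette
`w`, the hole `(w.1 − 1, w.2)` absent, the far cell `f = (w.1 − 2, w.2)`, the western pocket
`pocketSW w = (w.1 − 3, w.2 − 1)` (the cell below `farWW = (w.1 − 3, w.2)`). §1–§2 ★★★★ THE LOWER HALF-PLANE even–odd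
rule: the cells below the root row, `{c : c.2 ≤ w.2 − 1}`, are entered and left only through the unit edges of the root
row's bottom line (`IsRootRowEdge`); a class-`B2a` UNDER-walk at the far cell (first side `S`) has its excursion
start and end in the far cell's `N`/`W` neighbours (rows `≥ w.2`: the exit and return sides are not `S`, and not `E` —
the hole), so it crosses that line an even number of times; the crossings at columns `≥ w.1` ARE the eastern ray
count, the crossing below the hole is impossible, the one below the far cell is the first hit itself (index `F`, not an
excursion index), the one below `farWW` is the pocket's top side — shut once the pocket is absent — and those further
west are shut by hypothesis (`(x, w.2) ∉ D ∨ (x, w.2 − 1) ∉ D` for `x ≤ w.1 − 4`: the pocket sits ON the western wall).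
Hence ★★★★ `ΩG.AJ_root_eq_zero_of_under_wallPocketSW` and ★★★★★ `ΩG.WE_eq_excursionWinding_of_under_wallPocketSW`: NO
UNDER-WALK IS WOUND — the under route is EMPTY (`ΩG.sum_routeMassW_S_eq_zero_of_wallPocketSW`); row mirror: the
north-western pocket on the wall empties the over route. §3 with the two over blocks present ⇒ ★★★★★
`im_vertexFunctional_printed_pos_of_wallPocketSW` (`Im VF(θ) > 0` for every `θ ∈ [π/3, 2π/3]`),
`vertexFunctional_printed_ne_zero_of_wallPocketSW`; mirror `Im VF(θ) < 0`. §4 ALL BOXES with the hole two columns from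
the western wall (`h.1 = 2`, `h.1 + 3 ≤ m`, `2 ≤ h.2`, `h.2 + 3 ≤ n`): removing the wall cell `(0, h.2 − 1)` alone ⇒
★★★★★ `lawL_box_wallPocketSW_vertexFunctional_ne_zero` (no zero on the whole range) and
`lawL_box_wallPocketSW_not_wound_under`; removing `(0, h.2 + 1)` ⇒ `lawL_box_wallPocketNW_im_neg`. These are two of LAW L's
west «residual» cells: «empties a route» cells with a definite sign, matching kit j285711 of the lane (no free wound
under-walk found avoiding `(1,1)` in any tested block). In the interior (a column present west of the pocket) the
pocket's removal kills nothing (`PlaquetteWalkHoleRootLawLDichotomy`): the wall is what seals the lower half-plane.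

Not in print; venture lane «pcv-sawmu», seat b-step0 gen 26.

References: A. Glazman, I. Manolescu, arXiv:1708.00395v3, §1 (Fig. 1, Fig. 2), §2.1, §4.2 and Lemma 2.1
[GlazmanManolescu2019]; A. Glazman, Electron. Commun. Probab. 20 (2015) no. 86, Lemma 3.1, proof pp. 6–7
[Glazman2015WeightedSAW]; R. Courant, H. Robbins, *What is Mathematics?* (1941/1958), Ch. V Appendix §2 (the even–odd
rule) [CourantRobbins1958].
-/

noncomputable section

open Set Function Complex

namespace Literature.Probability.RandomPlanarGeometry.SAW.YangBaxter

open Real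
open Literature.Barriers.CriticalPhenomena.PlaquetteWalk (mirrorRowFace mirrorRowFace_mirrorRowFace)

open private fc_ne from Literature.Probability.RandomPlanarGeometry.YangBaxterSAWGeneralDomain
open private side_jOut from Literature.Probability.RandomPlanarGeometry.YangBaxterSAWExcursionJordan

/-! ## §1 The lower half-plane and the root row's bottom line -/

section LowerHalf

variable (w : Face)

/-- The unit edges of the bottom line of the root row: the `S` sides of the cells `(x, w.2)`.
[cite: CourantRobbins1958, Ch. V Appendix §2 (The Jordan Curve Theorem for Polygons: the even–odd rule)] -/
def IsRootRowEdge : MidEdge → Prop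
  | .slant _ y => y = w.2
  | .vert _ _ => False

/-- **Crossing into the lower half-plane**: two distinct faces sharing the mid-edge `e` lie on different sides of the
root row's bottom line iff `e` is one of its unit edges. [cite: CourantRobbins1958, Ch. V Appendix §2 (the even–odd rule)] -/
theorem lowerHalf_change_iff {e : MidEdge} {F₁ F₂ : Face} (h₁ : ∃ s, F₁.side s = e) (h₂ : ∃ s, F₂.side s = e)
    (hne : F₁ ≠ F₂) : ¬(F₁.2 ≤ w.2 - 1 ↔ F₂.2 ≤ w.2 - 1) ↔ IsRootRowEdge w e := by
  rcases (Face.exists_side_eq_iff F₁ e).1 h₁ with e₁ | e₁ <;> rcases (Face.exists_side_eq_iff F₂ e).1 h₂ with e₂ | e₂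
  · exact absurd (e₁.trans e₂.symm) hne
  · subst e₁; subst e₂
    cases e with
    | vert x y => simp [MidEdge.faces, IsRootRowEdge]
    | slant x y => simp only [MidEdge.faces, IsRootRowEdge]; omega
  · subst e₁; subst e₂
    cases e with
    | vert x y => simp [MidEdge.faces, IsRootRowEdge]
    | slant x y => simp only [MidEdge.faces, IsRootRowEdge]; omega
  · exact absurd (e₁.trans e₂.symm) hne

/-- A root-row edge at a column `≥ w.1` is an edge of the eastern ray of the hole, and conversely.
[cite: CourantRobbins1958, Ch. V Appendix §2 (the even–odd rule)] -/
theorem isRootRowEdge_ray_iff (e : MidEdge) :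
    (IsRootRowEdge w e ∧ w.1 ≤ e.faces.2.1) ↔ ∃ m : ℕ, e = rayMid (holeFaceW w) .E m := by
  constructor
  · rintro ⟨h, hx⟩
    cases e with
    | vert x y => exact absurd h (by simp [IsRootRowEdge])
    | slant x y =>
      simp only [IsRootRowEdge] at h
      simp only [MidEdge.faces] at hx
      refine ⟨(x - w.1).toNat, ?_⟩
      rw [rayMid_holeFaceW_E_eq]
      subst h
      congr 1
      omega
  · rintro ⟨m, rfl⟩
    rw [rayMid_holeFaceW_E_eq]
    simp only [IsRootRowEdge, MidEdge.faces, true_and]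
    omega

/-- A face next to the far cell at its `N` or `W` side, other than the far cell, lies in a row `≥ w.2`.
[cite: GlazmanManolescu2019, §1 (the lattice of rhombi and its mid-edges)] -/
theorem not_lower_of_side_farW_NW {F : Face} {s t : Side} (h : F.side s = (farW w).side t) (hne : F ≠ farW w)
    (ht : t = .W ∨ t = .N) : ¬F.2 ≤ w.2 - 1 := by
  rcases ht with rfl | rfl <;>
    rcases (Face.exists_side_eq_iff F ((farW w).side _)).1 ⟨s, h⟩ with e | e <;>
      obtain ⟨k, j⟩ := w <;>
        simp only [farW, Face.side, MidEdge.faces] at e hne ⊢ <;>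
        (subst e; first | (exact absurd rfl hne) | (simp only [not_le]; omega))

end LowerHalf

namespace ΩG

variable {D : Set Face} {w : Face}

/-! ## §2 The pocket on the wall: no under-walk is wound -/

/-- ★★★★ **THE WESTERN POCKET ON THE WALL ⇒ THE EXCURSION POLYGON OF AN UNDER-WALK NEVER WINDS AROUND THE ROOT.**
Hole absent, `pocketSW w ∉ D`, and west of the pocket the root row's bottom line shut (`(x, w.2) ∉ D ∨ (x, w.2 − 1) ∉ D`
for `x ≤ w.1 − 4`). For a class-`B2a` walk that first reaches the far cell from `S`: its excursion starts and ends in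
rows `≥ w.2` (exit and return sides are `N`/`W`), so it crosses the root row's bottom line an even number of times
(even–odd rule for the lower half-plane); every crossing is at a column `≥ w.1` (below the hole: the hole; below the
far cell: that edge is the first hit, index `F`; below `farWW`: the pocket; further west: shut) — so the eastern ray
count is even and the swept angle at the root is `0`. [cite: CourantRobbins1958, Ch. V Appendix §2 (the even–odd rule)]
[cite: Glazman2015WeightedSAW, Lemma 3.1 (proof, pp. 6–7)] [cite: GlazmanManolescu2019, §1 (Fig. 2), Lemma 2.1] -/
theorem AJ_root_eq_zero_of_under_wallPocketSW (hh : holeFaceW w ∉ D) (hP : pocketSW w ∉ D)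
    (hwest : ∀ x : ℤ, x ≤ w.1 - 4 → ((x, w.2) : Face) ∉ D ∨ ((x, w.2 - 1) : Face) ∉ D)
    (ω : ΩG D (w.side .W) (farW w)) (hr : RootedFace D (w.side .W) (farW w)) (h : ω.IsB2a)
    (hS : ω.2.firstSideG = .S) : ω.AJ hr h (toC (midPt (w.side .W))) = 0 := by
  classical
  by_contra hA
  have hodd := (ω.AJ_root_ne_zero_iff_odd_rayCountAt (hr := hr) h (b := holeFaceW w) (τ := .E)
    (holeFaceW_side_E w)).1 hA
  have hF := ω.fh_lt h
  have hB2 : ω.2.firstHitG + 1 < ω.2.arcs.length := h.1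
  set F := ω.2.firstHitG with hFdef
  set n := ω.2.arcs.length with hndef
  have hnthF : ω.2.nth F = (farW w).side .S := by rw [hFdef, ω.2.nth_firstHitG, hS]
  -- the exit side and the return side are `N` or `W`
  have hexit : ω.2.exitSideG hr hF = .W ∨ ω.2.exitSideG hr hF = .N := by
    have hne := (ω.2.exitSide_specG hr hF).2
    rw [hS] at hne
    have hd := ω.2.door_nth (j := F + 1) (by omega) (by omega)
    rw [(ω.2.exitSide_specG hr hF).1] at hd
    cases hx : ω.2.exitSideG hr hF with
    | W => exact Or.inl rfl
    | N => exact Or.inr rfl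
    | S => exact absurd hx hne
    | E => rw [hx, farW_side_E_faces] at hd; exact absurd hd.2 hh
  have hret : ω.1 = .W ∨ ω.1 = .N := fst_eq_W_or_N hh hr h hS
  let b : ℕ → Bool := fun k => decide ((ω.2.fc k).2 ≤ w.2 - 1)
  have hbF : b (F + 1) = false := by
    have hin := (ω.2.side_sIn_nth (i := F + 1) hB2).1
    rw [(ω.2.exitSide_specG hr hF).1] at hin
    have hne : ω.2.fc (F + 1) ≠ farW w := fc_ne ω hr h (by omega) hB2
    simp only [b, decide_eq_false_iff_not]
    exact not_lower_of_side_farW_NW w hin hne hexit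
  have hbL : b (n - 1) = false := by
    have hout := (ω.2.side_sIn_nth (i := n - 1) (by omega)).2.1
    rw [show n - 1 + 1 = n by omega, ω.2.nth_length] at hout
    have hne : ω.2.fc (n - 1) ≠ farW w := fc_ne ω hr h (by omega) (by omega)
    simp only [b, decide_eq_false_iff_not]
    exact not_lower_of_side_farW_NW w hout hne hret
  have heven := (even_card_changes_iff b (F + 1) (n - 1) (by omega)).2 (hbF.trans hbL.symm)
  set K := Finset.Ioc (F + 1) (n - 1) with hKdef
  -- the two faces of the `k`-th edge, and a change of half-plane is a root-row edge
  have hchg : ∀ k ∈ K, (b (k - 1) ≠ b k ↔ IsRootRowEdge w (ω.2.nth k)) := by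
    intro k hk
    rw [hKdef, Finset.mem_Ioc] at hk
    have hout := (ω.2.side_sIn_nth (i := k - 1) (by omega)).2.1
    have hin := (ω.2.side_sIn_nth (i := k) (by omega)).1
    rw [show k - 1 + 1 = k by omega] at hout
    have hne : ω.2.fc (k - 1) ≠ ω.2.fc (k - 1 + 1) := YBWalk.fc_succ_ne (by omega)
    rw [show k - 1 + 1 = k by omega] at hne
    have key := lowerHalf_change_iff w ⟨_, hout⟩ ⟨_, hin⟩ hne
    simp only [b, ne_eq, decide_eq_decide]
    exact key
  -- every root-row crossing of the excursion is at a column `≥ w.1`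
  have hcol : ∀ k ∈ K, IsRootRowEdge w (ω.2.nth k) → w.1 ≤ (ω.2.nth k).faces.2.1 := by
    intro k hk hrow
    rw [hKdef, Finset.mem_Ioc] at hk
    have hd := ω.2.door_nth (j := k) (by omega) (by omega)
    cases hnth : ω.2.nth k with
    | vert x y => rw [hnth] at hrow; exact absurd hrow (by simp [IsRootRowEdge])
    | slant x y =>
      rw [hnth] at hrow hd
      simp only [IsRootRowEdge] at hrow
      subst hrow
      simp only [MidEdge.faces] at hd ⊢
      by_contra hlt
      push Not at hlt
      rcases lt_or_eq_of_le (show x ≤ w.1 - 1 by omega) with h1 | h1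
      · rcases lt_or_eq_of_le (show x ≤ w.1 - 2 by omega) with h2 | h2
        · rcases lt_or_eq_of_le (show x ≤ w.1 - 3 by omega) with h3 | h3
          · rcases hwest x (by omega) with hx | hx
            · exact hx hd.2
            · exact hx hd.1
          · apply hP
            have e : pocketSW w = (x, w.2 - 1) := by rw [h3]; rfl
            rw [e]; exact hd.1
        · -- below the far cell: this edge is the first hit, at index `F`
          have e : ω.2.nth k = ω.2.nth F := by
            rw [hnth, hnthF, h2]; obtain ⟨a, c⟩ := w; rfl
          have := ω.2.nth_inj_of_le (by omega) (by omega) e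
          omega
      · apply hh
        have e : holeFaceW w = (x, w.2) := by rw [h1]; rfl
        rw [e]; exact hd.2
  set T := K.filter fun k => IsRootRowEdge w (ω.2.nth k) with hTdef
  have hTeq : (K.filter fun k => b (k - 1) ≠ b k) = T := by
    ext k
    simp only [hTdef, Finset.mem_filter]
    exact ⟨fun ⟨hk, hb⟩ => ⟨hk, (hchg k hk).1 hb⟩, fun ⟨hk, ht⟩ => ⟨hk, (hchg k hk).2 ht⟩⟩
  rw [hTeq] at heven
  have hT : T.card = ω.rayCountAt hr h (holeFaceW w) .E := by
    unfold ΩG.rayCountAt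
    have hexit' : ∀ j < ω.Mv, (ω.jFace h j).side (ω.jOut hr h j) = ω.2.nth (F + j + 1) :=
      fun j hj => side_jOut (hr := hr) h hj
    have hFM : F + ω.Mv = n := by unfold ΩG.Mv; omega
    symm
    refine Finset.card_bij' (fun j _ => F + j + 1) (fun k _ => k - F - 1) ?_ ?_ ?_ ?_
    · intro j hj
      rw [Finset.mem_filter, Finset.mem_range] at hj
      obtain ⟨hjM, m, hm⟩ := hj
      rw [hexit' j hjM] at hm
      have hlt : F + j + 1 ≤ n - 1 ∧ F + 2 ≤ F + j + 1 := by
        have h1 : F + j + 1 ≠ n := by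
          intro e
          rw [e, ω.2.nth_length, rayMid_holeFaceW_E_eq] at hm
          exact farW_side_ne_slant_east w ω.1 m hm
        have h2 : j ≠ 0 := by
          rintro rfl
          rw [Nat.add_zero, (ω.2.exitSide_specG hr hF).1, rayMid_holeFaceW_E_eq] at hm
          exact farW_side_ne_slant_east w _ m hm
        omega
      rw [hTdef, Finset.mem_filter, hKdef, Finset.mem_Ioc]
      exact ⟨⟨by omega, hlt.1⟩, ((isRootRowEdge_ray_iff w _).2 ⟨m, hm⟩).1⟩
    · intro k hk
      have hk' := hk
      rw [hTdef, Finset.mem_filter] at hk'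
      obtain ⟨hkK, ht⟩ := hk'
      have hx := hcol k hkK ht
      rw [hKdef, Finset.mem_Ioc] at hkK
      obtain ⟨m, hm⟩ := (isRootRowEdge_ray_iff w _).1 ⟨ht, hx⟩
      rw [Finset.mem_filter, Finset.mem_range]
      refine ⟨by omega, m, ?_⟩
      rw [hexit' _ (by omega), show F + (k - F - 1) + 1 = k by omega]
      exact hm
    · intro j hj; omega
    · intro k hk
      rw [hTdef, Finset.mem_filter, hKdef, Finset.mem_Ioc] at hk
      omega
  rw [hT] at heven
  exact Nat.not_even_iff_odd.2 hodd heven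

/-- ★★★★★ **THE WESTERN POCKET ON THE WALL EMPTIES THE UNDER ROUTE**: no class-`B2a` under-walk at the far cell is
wound (both orientations of the winding witness have swept angle `0`).
[cite: GlazmanManolescu2019, Lemma 2.1 (statement, "in the form given in [Gl]"), §1 (Fig. 2)]
[cite: Glazman2015WeightedSAW, Lemma 3.1 (proof, pp. 6–7)] [cite: CourantRobbins1958, Ch. V Appendix §2 (the even–odd rule)] -/
theorem WE_eq_excursionWinding_of_under_wallPocketSW (hh : holeFaceW w ∉ D) (hP : pocketSW w ∉ D)
    (hwest : ∀ x : ℤ, x ≤ w.1 - 4 → ((x, w.2) : Face) ∉ D ∨ ((x, w.2 - 1) : Face) ∉ D)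
    (ω : ΩG D (w.side .W) (farW w)) (hr : RootedFace D (w.side .W) (farW w)) (h : ω.IsB2a)
    (hS : ω.2.firstSideG = .S) (θ : ℝ) :
    ω.WE (fun _ => θ) = excursionWinding θ ω.2.firstSideG (ω.z1 hr h) ω.1 := by
  by_contra hW
  rcases ω.AJ_ne_zero_or_rev_of_wound hr h θ hW with hA | hA
  · exact hA (AJ_root_eq_zero_of_under_wallPocketSW hh hP hwest ω hr h hS)
  · have h' := ω.rev_isB2a hr h
    have hS' : (ω.rev hr).2.firstSideG = .S := by rw [ω.rev_firstSide hr h]; exact hS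
    exact hA (AJ_root_eq_zero_of_under_wallPocketSW hh hP hwest (ω.rev hr) hr h' hS')

/-- ★★★ The under route mass vanishes identically once the western pocket on the wall is absent.
[cite: GlazmanManolescu2019, Lemma 2.1 (statement, "in the form given in [Gl]")] -/
theorem sum_routeMassW_S_eq_zero_of_wallPocketSW [Finite D] (hh : holeFaceW w ∉ D) (hP : pocketSW w ∉ D)
    (hwest : ∀ x : ℤ, x ≤ w.1 - 4 → ((x, w.2) : Face) ∉ D ∨ ((x, w.2 - 1) : Face) ∉ D)
    (hr : RootedFace D (w.side .W) (farW w)) (θ : ℝ) :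
    ∑ ω ∈ setB2a D (w.side .W) (farW w), routeMassW θ hr .S ω = 0 := by
  classical
  refine Finset.sum_eq_zero fun ω _ => ?_
  unfold routeMassW
  split_ifs with h1 h2
  · exact absurd (WE_eq_excursionWinding_of_under_wallPocketSW hh hP hwest ω hr h1 h2.1 θ) h2.2
  · rfl
  · rfl

/-! ## §2b Row mirror: the north-western pocket on the wall empties the over route -/

/-- The reflection on a cell, in coordinates. [cite: GlazmanManolescu2019, §4.2 (lattice symmetries)] -/
private theorem mirrorRowFace_mkWP (w : Face) (x y : ℤ) : mirrorRowFace w.2 ((x, y) : Face) = (x, 2 * w.2 - y) := by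
  simp [mirrorRowFace]

/-- ★★★★★ **THE NORTH-WESTERN POCKET ON THE WALL EMPTIES THE OVER ROUTE** (row mirror): hole absent,
`pocketNW w = (w.1 − 3, w.2 + 1)` absent, the root row's top line shut west of it ⇒ no over-walk is wound.
[cite: GlazmanManolescu2019, §1 (Fig. 1, Fig. 2), §4.2 (lattice symmetries), Lemma 2.1] [cite: Glazman2015WeightedSAW, Lemma 3.1 (proof, pp. 6–7)] -/
theorem WE_eq_excursionWinding_of_over_wallPocketNW (hh : holeFaceW w ∉ D) (hP : pocketNW w ∉ D)
    (hwest : ∀ x : ℤ, x ≤ w.1 - 4 → ((x, w.2) : Face) ∉ D ∨ ((x, w.2 + 1) : Face) ∉ D)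
    (ω : ΩG D (w.side .W) (farW w)) (hr : RootedFace D (w.side .W) (farW w)) (h : ω.IsB2a)
    (hN : ω.2.firstSideG = .N) (θ : ℝ) :
    ω.WE (fun _ => θ) = excursionWinding θ ω.2.firstSideG (ω.z1 hr h) ω.1 := by
  by_contra hW
  have hr' := rootedFace_rowMirrorDom w hr
  have h' := ω.mirrorFar_isB2a hr h
  have hh' : holeFaceW w ∉ rowMirrorDom w D := by rwa [mem_rowMirrorDom, mirrorRowFace_holeFaceW]
  have hP' : pocketSW w ∉ rowMirrorDom w D := by
    rw [mem_rowMirrorDom, show pocketSW w = ((w.1 - 3, w.2 - 1) : Face) from rfl, mirrorRowFace_mkWP,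
      show 2 * w.2 - (w.2 - 1) = w.2 + 1 by ring]
    exact hP
  have hwest' : ∀ x : ℤ, x ≤ w.1 - 4 → ((x, w.2) : Face) ∉ rowMirrorDom w D ∨
      ((x, w.2 - 1) : Face) ∉ rowMirrorDom w D := by
    intro x hx
    simp only [mem_rowMirrorDom, mirrorRowFace_mkWP, show 2 * w.2 - w.2 = w.2 by ring,
      show 2 * w.2 - (w.2 - 1) = w.2 + 1 by ring]
    exact hwest x hx
  have hS' : ω.mirrorFar.2.firstSideG = .S := by rw [mirrorFar_firstSideG, hN]; rfl
  exact absurd (WE_eq_excursionWinding_of_under_wallPocketSW hh' hP' hwest' ω.mirrorFar hr' h' hS' _)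
    (ω.mirrorFar_wound hr h hW)

/-- ★★★ The over route mass vanishes identically once the north-western pocket on the wall is absent.
[cite: GlazmanManolescu2019, Lemma 2.1 (statement, "in the form given in [Gl]")] -/
theorem sum_routeMassW_N_eq_zero_of_wallPocketNW [Finite D] (hh : holeFaceW w ∉ D) (hP : pocketNW w ∉ D)
    (hwest : ∀ x : ℤ, x ≤ w.1 - 4 → ((x, w.2) : Face) ∉ D ∨ ((x, w.2 + 1) : Face) ∉ D)
    (hr : RootedFace D (w.side .W) (farW w)) (θ : ℝ) :
    ∑ ω ∈ setB2a D (w.side .W) (farW w), routeMassW θ hr .N ω = 0 := by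
  classical
  refine Finset.sum_eq_zero fun ω _ => ?_
  unfold routeMassW
  split_ifs with h1 h2
  · exact absurd (WE_eq_excursionWinding_of_over_wallPocketNW hh hP hwest ω hr h1 h2.1 θ) h2.2
  · rfl
  · rfl

end ΩG

end Literature.Probability.RandomPlanarGeometry.SAW.YangBaxter

namespace Literature.Barriers.CriticalPhenomena.PlaquetteWalk

open Literature.Probability.RandomPlanarGeometry.SAW.YangBaxter
open Real Complex

/-! ## §3 The signs -/

section Signs

variable {Dl : List Face} {w : Face}

/-- ★★★★★ **WESTERN POCKET ON THE WALL ⇒ `Im VF(θ) > 0` FOR EVERY `θ ∈ [π/3, 2π/3]`**: hole absent, the pocket absent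
and the root row's bottom line shut west of it, the two over blocks present. At the endpoints the free over witnesses and
the empty under route give the sign; inside, `Im VF = v · M_N − v · M_S` with `M_S = 0` and `M_N > 0`.
[cite: GlazmanManolescu2019, Lemma 2.1 (statement, "in the form given in [Gl]"), §1 eq. (1)]
[cite: Glazman2015WeightedSAW, Lemma 3.1 (proof, pp. 6–7)] [cite: CourantRobbins1958, Ch. V Appendix §2 (the even–odd rule)] -/
theorem im_vertexFunctional_printed_pos_of_wallPocketSW {θ : ℝ} (hθ : θ ∈ Set.Icc (π / 3) (2 * π / 3))
    (hBW : ∀ c ∈ overBlockW w, c ∈ Dl) (hBE : ∀ c ∈ overBlockE w, c ∈ Dl)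
    (hf : farW w ∈ Dl) (hh : holeFaceW w ∉ dom Dl) (hP : pocketSW w ∉ dom Dl)
    (hwest : ∀ x : ℤ, x ≤ w.1 - 4 → ((x, w.2) : Face) ∉ dom Dl ∨ ((x, w.2 - 1) : Face) ∉ dom Dl) :
    0 < (vertexFunctional (printedWeights θ) tFiveEighths (ybCoeff θ) Dl (w.side .W) (farW w)).im := by
  have hr : RootedFace (dom Dl) (w.side .W) (farW w) := ⟨hf, fun hb => hh (by rw [root_faces_W] at hb; exact hb.1)⟩
  have hkill : ∀ (ω : ΩG (dom Dl) (w.side .W) (farW w)) (h : ω.IsB2a), ω.2.firstSideG = .S →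
      ω.WE (fun _ => θ) ≠ excursionWinding θ ω.2.firstSideG (ω.z1 hr h) ω.1 → ¬ω.2.W2FreeOff (farW w) :=
    fun ω h hS hW => absurd (ΩG.WE_eq_excursionWinding_of_under_wallPocketSW hh hP hwest ω hr h hS θ) hW
  have hkill1 : ∀ (ω : ΩG (dom Dl) (w.side .W) (farW w)) (h : ω.IsB2a), ω.2.firstSideG = .S →
      ω.WE (fun _ => θ) ≠ excursionWinding θ ω.2.firstSideG (ω.z1 hr h) ω.1 → ¬ω.2.W1FreeOff (farW w) :=
    fun ω h hS hW => absurd (ΩG.WE_eq_excursionWinding_of_under_wallPocketSW hh hP hwest ω hr h hS θ) hW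
  rcases eq_or_lt_of_le hθ.1 with e1 | h1
  · subst e1
    exact im_vertexFunctional_printed_farCellW_pi_div_three_pos_of_under_killed Dl w hf hh hr hkill
      (exists_over_w2free_of_overBlockW hBW hr _)
  rcases eq_or_lt_of_le hθ.2 with e2 | h2
  · subst e2
    exact im_vertexFunctional_printed_farCellW_two_pi_div_three_pos_of_under_killed Dl w hf hh hr hkill1
      (exists_over_w1free_of_overBlockE hBE hr _)
  have hθo : θ ∈ Set.Ioo (π / 3) (2 * π / 3) := ⟨h1, h2⟩
  rw [vertexFunctional_printed_farCellW_im_eq hθ Dl w hf hh hr,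
    ΩG.sum_routeMassW_S_eq_zero_of_wallPocketSW hh hP hwest hr θ, sub_zero]
  obtain ⟨ω, h, hN, hW, -⟩ := exists_over_w2free_of_overBlockW hBW hr θ
  exact mul_pos (weightV_pos_of_mem_Ioo ⟨by linarith [hθo.1, Real.pi_pos], by linarith [hθo.2, Real.pi_pos]⟩)
    (ΩG.sum_routeMassW_pos_of_wound hr .N hθo ⟨ω, h, hN, hW⟩)

/-- ★★★★★ **WESTERN POCKET ON THE WALL ⇒ NO ZERO OF THE FAR-CELL VERTEX FUNCTIONAL ON `[π/3, 2π/3]`.**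
[cite: GlazmanManolescu2019, Lemma 2.1 (statement, "in the form given in [Gl]")] [cite: Glazman2015WeightedSAW, Lemma 3.1 (proof, pp. 6–7)] -/
theorem vertexFunctional_printed_ne_zero_of_wallPocketSW {θ : ℝ} (hθ : θ ∈ Set.Icc (π / 3) (2 * π / 3))
    (hBW : ∀ c ∈ overBlockW w, c ∈ Dl) (hBE : ∀ c ∈ overBlockE w, c ∈ Dl)
    (hf : farW w ∈ Dl) (hh : holeFaceW w ∉ dom Dl) (hP : pocketSW w ∉ dom Dl)
    (hwest : ∀ x : ℤ, x ≤ w.1 - 4 → ((x, w.2) : Face) ∉ dom Dl ∨ ((x, w.2 - 1) : Face) ∉ dom Dl) :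
    vertexFunctional (printedWeights θ) tFiveEighths (ybCoeff θ) Dl (w.side .W) (farW w) ≠ 0 := by
  intro e
  have hpos := im_vertexFunctional_printed_pos_of_wallPocketSW hθ hBW hBE hf hh hP hwest
  rw [e, Complex.zero_im] at hpos
  exact lt_irrefl _ hpos

/-- ★★★★★ **NORTH-WESTERN POCKET ON THE WALL ⇒ `Im VF(θ) < 0` FOR EVERY `θ ∈ [π/3, 2π/3]`** (row mirror; both under
blocks present). [cite: GlazmanManolescu2019, Lemma 2.1 (statement, "in the form given in [Gl]"), §1 eq. (1)]
[cite: Glazman2015WeightedSAW, Lemma 3.1 (proof, pp. 6–7)] -/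
theorem im_vertexFunctional_printed_neg_of_wallPocketNW {θ : ℝ} (hθ : θ ∈ Set.Icc (π / 3) (2 * π / 3))
    (hBW : ∀ c ∈ underBlockW w, c ∈ Dl) (hBE : ∀ c ∈ underBlockE w, c ∈ Dl)
    (hf : farW w ∈ Dl) (hh : holeFaceW w ∉ dom Dl) (hP : pocketNW w ∉ dom Dl)
    (hwest : ∀ x : ℤ, x ≤ w.1 - 4 → ((x, w.2) : Face) ∉ dom Dl ∨ ((x, w.2 + 1) : Face) ∉ dom Dl) :
    (vertexFunctional (printedWeights θ) tFiveEighths (ybCoeff θ) Dl (w.side .W) (farW w)).im < 0 := by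
  have hr : RootedFace (dom Dl) (w.side .W) (farW w) := ⟨hf, fun hb => hh (by rw [root_faces_W] at hb; exact hb.1)⟩
  have hkill : ∀ (ω : ΩG (dom Dl) (w.side .W) (farW w)) (h : ω.IsB2a), ω.2.firstSideG = .N →
      ω.WE (fun _ => θ) ≠ excursionWinding θ ω.2.firstSideG (ω.z1 hr h) ω.1 → ¬ω.2.W1FreeOff (farW w) :=
    fun ω h hN hW => absurd (ΩG.WE_eq_excursionWinding_of_over_wallPocketNW hh hP hwest ω hr h hN θ) hW
  have hkill2 : ∀ (ω : ΩG (dom Dl) (w.side .W) (farW w)) (h : ω.IsB2a), ω.2.firstSideG = .N →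
      ω.WE (fun _ => θ) ≠ excursionWinding θ ω.2.firstSideG (ω.z1 hr h) ω.1 → ¬ω.2.W2FreeOff (farW w) :=
    fun ω h hN hW => absurd (ΩG.WE_eq_excursionWinding_of_over_wallPocketNW hh hP hwest ω hr h hN θ) hW
  rcases eq_or_lt_of_le hθ.1 with e1 | h1
  · subst e1
    exact im_vertexFunctional_printed_farCellW_pi_div_three_neg_of_over_killed Dl w hf hh hr hkill2
      (exists_under_w2free_of_underBlockE hBE hr _)
  rcases eq_or_lt_of_le hθ.2 with e2 | h2
  · subst e2
    exact im_vertexFunctional_printed_farCellW_two_pi_div_three_neg_of_over_killed Dl w hf hh hr hkill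
      (exists_under_w1free_of_underBlockW hBW hr _)
  have hθo : θ ∈ Set.Ioo (π / 3) (2 * π / 3) := ⟨h1, h2⟩
  rw [vertexFunctional_printed_farCellW_im_eq hθ Dl w hf hh hr,
    ΩG.sum_routeMassW_N_eq_zero_of_wallPocketNW hh hP hwest hr θ, zero_sub, mul_neg, neg_lt_zero]
  obtain ⟨ω, h, hS, hW, -⟩ := exists_under_w1free_of_underBlockW hBW hr θ
  exact mul_pos (weightV_pos_of_mem_Ioo ⟨by linarith [hθo.1, Real.pi_pos], by linarith [hθo.2, Real.pi_pos]⟩)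
    (ΩG.sum_routeMassW_pos_of_wound hr .S hθo ⟨ω, h, hS, hW⟩)

end Signs

/-! ## §4 LAW L's residual west cells, all boxes -/

section Boxes

variable {m n : ℕ} {h : Face}

/-- The two over blocks fit in the box when the hole is two columns from the western wall and the wall cell
`(0, h.2 − 1)` is removed. [cite: GlazmanManolescu2019, §2.1 (finite domains of faces)] -/
theorem overBlocks_hroot_subset_boxMinus_wallPocketSW (hW : h.1 = 2) (hE : h.1 + 3 ≤ m) (hS : 2 ≤ h.2)
    (hN : h.2 + 3 ≤ n) :
    (∀ c ∈ overBlockW (h.1 + 1, h.2), c ∈ boxMinus m n [h, (0, h.2 - 1)]) ∧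
      ∀ c ∈ overBlockE (h.1 + 1, h.2), c ∈ boxMinus m n [h, (0, h.2 - 1)] := by
  have bW : ∀ c ∈ overBlockW42, 1 ≤ c.1 ∧ c.1 ≤ 5 ∧ 1 ≤ c.2 ∧ c.2 ≤ 4 ∧ c ≠ (3, 2) ∧ c ≠ (1, 1) := by decide
  have bE : ∀ c ∈ overBlockE42, 1 ≤ c.1 ∧ c.1 ≤ 5 ∧ 1 ≤ c.2 ∧ c.2 ≤ 4 ∧ c ≠ (3, 2) ∧ c ≠ (1, 1) := by decide
  constructor
  · intro c hc
    simp only [overBlockW, List.mem_map] at hc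
    obtain ⟨a, ha, rfl⟩ := hc
    obtain ⟨b1, b2, b3, b4, b5, b6⟩ := bW a ha
    obtain ⟨x, y⟩ := a
    simp only [ne_eq, Prod.mk.injEq, not_and] at b1 b2 b3 b4 b5 b6
    rw [shiftBy_refShift_mk, mem_boxMinus]
    simp only [List.mem_cons, List.not_mem_nil, or_false, not_or]
    refine ⟨⟨by omega, by omega, by omega, by omega⟩, fun e => ?_, fun e => ?_⟩
    · have e' := Prod.ext_iff.1 e; simp only at e'; omega
    · have e' := Prod.ext_iff.1 e; simp only at e'; omega
  · intro c hc
    simp only [overBlockE, List.mem_map] at hc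
    obtain ⟨a, ha, rfl⟩ := hc
    obtain ⟨b1, b2, b3, b4, b5, b6⟩ := bE a ha
    obtain ⟨x, y⟩ := a
    simp only [ne_eq, Prod.mk.injEq, not_and] at b1 b2 b3 b4 b5 b6
    rw [shiftBy_refShift_mk, mem_boxMinus]
    simp only [List.mem_cons, List.not_mem_nil, or_false, not_or]
    refine ⟨⟨by omega, by omega, by omega, by omega⟩, fun e => ?_, fun e => ?_⟩
    · have e' := Prod.ext_iff.1 e; simp only at e'; omega
    · have e' := Prod.ext_iff.1 e; simp only at e'; omega

/-- ★★★★★ **LAW L's WEST RESIDUAL CELL `(0, h.2 − 1)`, ALL BOXES: NO ZERO ON THE WHOLE RANGE.** In the `m × n` box with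
the hole `h` two columns from the western wall (`h.1 = 2`, `h.1 + 3 ≤ m`, `2 ≤ h.2`, `h.2 + 3 ≤ n`), removing the wall
cell `(0, h.2 − 1)` — the western pocket of the root plaquette `(3, h.2)` — alone empties the under route and leaves
the over route free: `VF(θ) ≠ 0` for every `θ ∈ [π/3, 2π/3]`. [cite: GlazmanManolescu2019, Lemma 2.1 (statement, "in the form given in [Gl]"), §2.1]
[cite: Glazman2015WeightedSAW, Lemma 3.1 (proof, pp. 6–7)] -/
theorem lawL_box_wallPocketSW_vertexFunctional_ne_zero (hW : h.1 = 2) (hE : h.1 + 3 ≤ m) (hS : 2 ≤ h.2)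
    (hN : h.2 + 3 ≤ n) {θ : ℝ} (hθ : θ ∈ Set.Icc (π / 3) (2 * π / 3)) :
    vertexFunctional (printedWeights θ) tFiveEighths (ybCoeff θ) (boxMinus m n [h, (0, h.2 - 1)])
      (Face.side (h.1 + 1, h.2) .W) (farW (h.1 + 1, h.2)) ≠ 0 := by
  obtain ⟨hBW, hBE⟩ := overBlocks_hroot_subset_boxMinus_wallPocketSW hW hE hS hN
  refine vertexFunctional_printed_ne_zero_of_wallPocketSW hθ hBW hBE ?_ ?_ ?_ fun x hx => ?_
  · rw [mem_boxMinus]; simp only [farW, List.mem_cons, List.not_mem_nil, or_false, not_or]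
    refine ⟨⟨by omega, by omega, by omega, by omega⟩, fun e => ?_, fun e => ?_⟩
    · have e' := Prod.ext_iff.1 e; simp only at e'; omega
    · have e' := Prod.ext_iff.1 e; simp only at e'; omega
  · rw [holeFaceW_hroot]; exact not_mem_dom_boxMinus_of_mem (by simp)
  · have e : pocketSW ((h.1 + 1, h.2) : Face) = (0, h.2 - 1) := Prod.ext (by simp only [pocketSW]; omega) rfl
    rw [e]; exact not_mem_dom_boxMinus_of_mem (by simp)
  · left; intro hm; have hb := (mem_dom_boxMinus.1 hm).1; simp only at hb hx; omega

/-- ★★★★ In that box NO under-walk at the far cell is wound: the under route is EMPTY.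
[cite: GlazmanManolescu2019, Lemma 2.1 (statement, "in the form given in [Gl]")] [cite: Glazman2015WeightedSAW, Lemma 3.1 (proof, pp. 6–7)] -/
theorem lawL_box_wallPocketSW_not_wound_under (hW : h.1 = 2)
    (hr : RootedFace (dom (boxMinus m n [h, (0, h.2 - 1)])) (Face.side (h.1 + 1, h.2) .W) (farW (h.1 + 1, h.2)))
    (ω : ΩG (dom (boxMinus m n [h, (0, h.2 - 1)])) (Face.side (h.1 + 1, h.2) .W) (farW (h.1 + 1, h.2)))
    (hω : ω.IsB2a) (hSd : ω.2.firstSideG = .S) (θ : ℝ) :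
    ω.WE (fun _ => θ) = excursionWinding θ ω.2.firstSideG (ω.z1 hr hω) ω.1 := by
  refine ΩG.WE_eq_excursionWinding_of_under_wallPocketSW ?_ ?_ (fun x hx => ?_) ω hr hω hSd θ
  · rw [holeFaceW_hroot]; exact not_mem_dom_boxMinus_of_mem (by simp)
  · have e : pocketSW ((h.1 + 1, h.2) : Face) = (0, h.2 - 1) := Prod.ext (by simp only [pocketSW]; omega) rfl
    rw [e]; exact not_mem_dom_boxMinus_of_mem (by simp)
  · left; intro hm; have hb := (mem_dom_boxMinus.1 hm).1; simp only at hb hx; omega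

/-- The two under blocks fit in the box when the wall cell `(0, h.2 + 1)` is removed.
[cite: GlazmanManolescu2019, §2.1 (finite domains of faces)] -/
theorem underBlocks_hroot_subset_boxMinus_wallPocketNW (hW : h.1 = 2) (hE : h.1 + 3 ≤ m) (hS : 2 ≤ h.2)
    (hN : h.2 + 3 ≤ n) :
    (∀ c ∈ underBlockW (h.1 + 1, h.2), c ∈ boxMinus m n [h, (0, h.2 + 1)]) ∧
      ∀ c ∈ underBlockE (h.1 + 1, h.2), c ∈ boxMinus m n [h, (0, h.2 + 1)] := by
  have bW : ∀ c ∈ underBlockW42, 1 ≤ c.1 ∧ c.1 ≤ 5 ∧ 0 ≤ c.2 ∧ c.2 ≤ 3 ∧ c ≠ (3, 2) ∧ c ≠ (1, 3) := by decide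
  have bE : ∀ c ∈ underBlockE42, 1 ≤ c.1 ∧ c.1 ≤ 5 ∧ 0 ≤ c.2 ∧ c.2 ≤ 3 ∧ c ≠ (3, 2) ∧ c ≠ (1, 3) := by decide
  constructor
  · intro c hc
    simp only [underBlockW, List.mem_map] at hc
    obtain ⟨a, ha, rfl⟩ := hc
    obtain ⟨b1, b2, b3, b4, b5, b6⟩ := bW a ha
    obtain ⟨x, y⟩ := a
    simp only [ne_eq, Prod.mk.injEq, not_and] at b1 b2 b3 b4 b5 b6
    rw [shiftBy_refShift_mk, mem_boxMinus]
    simp only [List.mem_cons, List.not_mem_nil, or_false, not_or]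
    refine ⟨⟨by omega, by omega, by omega, by omega⟩, fun e => ?_, fun e => ?_⟩
    · have e' := Prod.ext_iff.1 e; simp only at e'; omega
    · have e' := Prod.ext_iff.1 e; simp only at e'; omega
  · intro c hc
    simp only [underBlockE, List.mem_map] at hc
    obtain ⟨a, ha, rfl⟩ := hc
    obtain ⟨b1, b2, b3, b4, b5, b6⟩ := bE a ha
    obtain ⟨x, y⟩ := a
    simp only [ne_eq, Prod.mk.injEq, not_and] at b1 b2 b3 b4 b5 b6
    rw [shiftBy_refShift_mk, mem_boxMinus]
    simp only [List.mem_cons, List.not_mem_nil, or_false, not_or]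
    refine ⟨⟨by omega, by omega, by omega, by omega⟩, fun e => ?_, fun e => ?_⟩
    · have e' := Prod.ext_iff.1 e; simp only at e'; omega
    · have e' := Prod.ext_iff.1 e; simp only at e'; omega

/-- ★★★★★ **LAW L's WEST RESIDUAL CELL `(0, h.2 + 1)`, ALL BOXES: `Im VF(θ) < 0` ON THE WHOLE RANGE** (the north-western
pocket on the wall empties the over route). [cite: GlazmanManolescu2019, Lemma 2.1 (statement, "in the form given in [Gl]"), §2.1]
[cite: Glazman2015WeightedSAW, Lemma 3.1 (proof, pp. 6–7)] -/
theorem lawL_box_wallPocketNW_im_neg (hW : h.1 = 2) (hE : h.1 + 3 ≤ m) (hS : 2 ≤ h.2) (hN : h.2 + 3 ≤ n) {θ : ℝ}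
    (hθ : θ ∈ Set.Icc (π / 3) (2 * π / 3)) :
    (vertexFunctional (printedWeights θ) tFiveEighths (ybCoeff θ) (boxMinus m n [h, (0, h.2 + 1)])
      (Face.side (h.1 + 1, h.2) .W) (farW (h.1 + 1, h.2))).im < 0 := by
  obtain ⟨hBW, hBE⟩ := underBlocks_hroot_subset_boxMinus_wallPocketNW hW hE hS hN
  refine im_vertexFunctional_printed_neg_of_wallPocketNW hθ hBW hBE ?_ ?_ ?_ fun x hx => ?_
  · rw [mem_boxMinus]; simp only [farW, List.mem_cons, List.not_mem_nil, or_false, not_or]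
    refine ⟨⟨by omega, by omega, by omega, by omega⟩, fun e => ?_, fun e => ?_⟩
    · have e' := Prod.ext_iff.1 e; simp only at e'; omega
    · have e' := Prod.ext_iff.1 e; simp only at e'; omega
  · rw [holeFaceW_hroot]; exact not_mem_dom_boxMinus_of_mem (by simp)
  · have e : pocketNW ((h.1 + 1, h.2) : Face) = (0, h.2 + 1) := Prod.ext (by simp only [pocketNW]; omega) rfl
    rw [e]; exact not_mem_dom_boxMinus_of_mem (by simp)
  · left; intro hm; have hb := (mem_dom_boxMinus.1 hm).1; simp only at hb hx; omega

end Boxes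

end Literature.Barriers.CriticalPhenomena.PlaquetteWalk
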